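import Mathlib.Analysis.SpecialFunctions.Pow.Real
import HarnessLib

/-!
# QUANT lane R8, T-DEC: KNAPSACK INEQUALITIES ARE DECIDED AT THEIR BREAKPOINTS — a concave piecewise-linear function of one variable lies below an
# affine function on `[0, ∞)` as soon as it does at `0`, at every kink, and at infinity (census-2 g59; the reduction of the single-mid criterion
# `decAtT_of_singleMid(_terms)` to finitely many cell inequalities)

builds on p205010 (kernel theorem, internal audit signed; external expert review pending)

Support file (`--supports stmt-CriticalPhenomena-4575`), QUANT lane seat prim-quant-census-2 (gen 59), rung R8 of
`run/shared/lean/prim/quant/LADDER.md`.  Memo `run/shared/lean/prim/quant/prim-quant-census-2-g59/ASSEMBLY-G59.md` §4.  Pure real analysis;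
theorems only, standard axioms, no sorries, no definitions.

* **`Quant.LawDec.knapsack_le_of_breakpoints`** — for a finite family of terms `(m_k, c_k ≥ 0)`, an extra slope `ν` and an affine bound
  `a + s·θ`: if `0 ≤ a`, `ν ≤ s` (the slope at infinity) and the inequality `Σ_k m_k·min(c_k, c_i) + ν·c_i ≤ a + s·c_i` holds at every kink
  `θ = c_i`, then `Σ_k m_k·min(c_k, θ) + ν·θ ≤ a + s·θ` for EVERY `θ ≥ 0`.
  (Both sides are piecewise affine with kinks among the `c_i`; so the inequality is decided at `0`, at the kinks, and by the slope beyond the last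
  kink.  Proof: induction on the number of terms, removing a term with the largest kink.)
USE.  In `decAtT_of_singleMid_terms` (`…QuantSingleMidTerms`) the hypothesis is exactly such an inequality for all `θ ≥ 0` (`m` = masses of the
compatible lows, `c` = their usages into the mid, `ν` = incompatible low mass, `a` = mass at the mid, `s` = giant mass `/u`); with this file a
cell proof checks it at the (at most four) usages only — census-1 g22's "breakpoint cells" B_k.

[this work]; elementary.  The gluing rows served [cite: KozmaNitzan2024, Conjecture 3 (p. 15)]; product measure [cite: Grimmett1999, §1.3 p. 10].
-/

noncomputable section

namespace Summit.CriticalPhenomena.PercolationContinuityZ3.Theorems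

namespace Quant

open Finset

namespace LawDec

variable {ι : Type}

/-- the induction behind `knapsack_le_of_breakpoints`: the statement on a window `[0, B]` for a finset `S` of terms, by induction on `S.card`,
removing a term with the largest kink. -/
theorem knapsack_le_of_breakpoints_aux [DecidableEq ι] (m c : ι → ℝ) (hc : ∀ i, 0 ≤ c i) (ν a : ℝ) (ha : 0 ≤ a) :
    ∀ (n : ℕ) (S : Finset ι), S.card = n → ∀ (s B : ℝ), 0 ≤ B →
      (∑ k ∈ S, m k * min (c k) B + ν * B ≤ a + s * B) →
      (∀ i ∈ S, c i ≤ B → ∑ k ∈ S, m k * min (c k) (c i) + ν * c i ≤ a + s * c i) →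
      ∀ θ, 0 ≤ θ → θ ≤ B → ∑ k ∈ S, m k * min (c k) θ + ν * θ ≤ a + s * θ := by
  intro n
  induction n with
  | zero =>
    intro S hS s B hB hend _ θ hθ0 hθB
    rw [Finset.card_eq_zero] at hS
    subst hS
    rw [Finset.sum_empty, zero_add] at hend ⊢
    -- affine on `[0, B]`: `(s - ν)·B ≥ -a` and `a ≥ 0` give `(s - ν)·θ ≥ -a` for `0 ≤ θ ≤ B`
    by_cases hsν : 0 ≤ s - ν
    · nlinarith [mul_nonneg hsν hθ0]
    · push Not at hsν
      nlinarith [mul_le_mul_of_nonpos_left hθB hsν.le]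
  | succ n ih =>
    intro S hS s B hB hend hkink θ hθ0 hθB
    have hne : S.Nonempty := by rw [← Finset.card_pos, hS]; omega
    obtain ⟨i₀, hi₀, hmax⟩ := Finset.exists_max_image S c hne
    set S' := S.erase i₀ with hS'
    have hcard : S'.card = n := by rw [hS', Finset.card_erase_of_mem hi₀, hS]; omega
    have hsplit : ∀ f : ι → ℝ, ∑ k ∈ S, f k = f i₀ + ∑ k ∈ S', f k := fun f => by
      rw [hS', ← Finset.add_sum_erase S f hi₀]
    by_cases hcB : B ≤ c i₀
    · -- the largest kink is beyond the window: on `[0, B]` the term `i₀` is linear, absorb it into the slope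
      have hlin : ∀ θ', 0 ≤ θ' → θ' ≤ B → min (c i₀) θ' = θ' := fun θ' _ h2 => min_eq_right (h2.trans hcB)
      have key := ih S' hcard (s - m i₀) B hB
        (by
          have := hend
          rw [hsplit, hlin B hB le_rfl] at this
          linarith)
        (by
          intro i hi hci
          have hiS : i ∈ S := Finset.mem_of_mem_erase hi
          have := hkink i hiS hci
          rw [hsplit, hlin (c i) (hc i) hci] at this
          linarith)
        θ hθ0 hθB
      rw [hsplit, hlin θ hθ0 hθB]
      linarith
    · push Not at hcB
      -- the largest kink `c i₀ < B`
      by_cases hθc : θ ≤ c i₀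
      · -- below it: induction on the window `[0, c i₀]`, the term `i₀` being linear there
        have hlin : ∀ θ', θ' ≤ c i₀ → min (c i₀) θ' = θ' := fun θ' h2 => min_eq_right h2
        have key := ih S' hcard (s - m i₀) (c i₀) (hc i₀)
          (by
            have := hkink i₀ hi₀ hcB.le
            rw [hsplit, hlin (c i₀) le_rfl] at this
            linarith)
          (by
            intro i hi hci
            have hiS : i ∈ S := Finset.mem_of_mem_erase hi
            have := hkink i hiS (hci.trans hcB.le)
            rw [hsplit, hlin (c i) hci] at this
            linarith)
          θ hθ0 hθc
        rw [hsplit, hlin θ hθc]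
        linarith
      · -- above every kink: the left side is `Σ m·c + ν·θ`, affine; interpolate between `θ = c i₀` and `θ = B`
        push Not at hθc
        have hconst : ∀ θ', c i₀ ≤ θ' → ∑ k ∈ S, m k * min (c k) θ' = ∑ k ∈ S, m k * c k := fun θ' h' =>
          Finset.sum_congr rfl fun k hk => by rw [min_eq_left ((hmax k hk).trans h')]
        have h1 := hkink i₀ hi₀ hcB.le
        have h2 := hend
        rw [hconst (c i₀) le_rfl] at h1
        rw [hconst B hcB.le] at h2
        rw [hconst θ hθc.le]
        -- `θ = (1-t)·c i₀ + t·B` with `t = (θ - c i₀)/(B - c i₀) ∈ [0,1]`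
        have hBc : 0 < B - c i₀ := by linarith
        set t := (θ - c i₀) / (B - c i₀) with ht
        have ht0 : 0 ≤ t := div_nonneg (by linarith) hBc.le
        have ht1 : t ≤ 1 := by rw [ht, div_le_one hBc]; linarith
        have hθt : θ = (1 - t) * c i₀ + t * B := by rw [ht]; field_simp; ring
        rw [hθt]
        nlinarith [mul_nonneg ht0 (by linarith : 0 ≤ a + s * B - (∑ k ∈ S, m k * c k + ν * B)),
          mul_nonneg (by linarith : 0 ≤ 1 - t) (by linarith : 0 ≤ a + s * c i₀ - (∑ k ∈ S, m k * c k + ν * c i₀))]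

/-- **KNAPSACK INEQUALITIES ARE DECIDED AT THEIR BREAKPOINTS.**  `c_k ≥ 0` (finitely many terms), `0 ≤ a`, `ν ≤ s`; if
`Σ_k m_k·min(c_k, c_i) + ν·c_i ≤ a + s·c_i` at every kink `c_i`, then `Σ_k m_k·min(c_k, θ) + ν·θ ≤ a + s·θ` for every `θ ≥ 0`. [this work] -/
theorem knapsack_le_of_breakpoints [Fintype ι] (m c : ι → ℝ) (hc : ∀ i, 0 ≤ c i) (ν a s : ℝ) (ha : 0 ≤ a)
    (hslope : ν ≤ s) (hkink : ∀ i, ∑ k, m k * min (c k) (c i) + ν * c i ≤ a + s * c i) (θ : ℝ) (hθ : 0 ≤ θ) :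
    ∑ k, m k * min (c k) θ + ν * θ ≤ a + s * θ := by
  classical
  -- window `[0, B]` with `B` = max(θ, all kinks); at `B` the left side is `Σ m·min(c,B) + ν B` and the bound holds by the largest kink / slope
  by_cases hne : (Finset.univ : Finset ι).Nonempty
  · obtain ⟨i₀, -, hmax⟩ := Finset.exists_max_image (Finset.univ : Finset ι) c hne
    set B := max θ (c i₀) with hB
    have hB0 : 0 ≤ B := le_max_of_le_left hθ
    have hconst : ∀ θ', c i₀ ≤ θ' → ∑ k, m k * min (c k) θ' = ∑ k, m k * c k := fun θ' h' =>
      Finset.sum_congr rfl fun k _ => by rw [min_eq_left ((hmax k (Finset.mem_univ k)).trans h')]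
    have hend : ∑ k, m k * min (c k) B + ν * B ≤ a + s * B := by
      have h1 := hkink i₀
      rw [hconst (c i₀) le_rfl] at h1
      rw [hconst B (le_max_right _ _)]
      have : c i₀ ≤ B := le_max_right _ _
      nlinarith
    exact knapsack_le_of_breakpoints_aux m c hc ν a ha _ Finset.univ rfl s B hB0 hend
      (fun i _ _ => hkink i) θ hθ (le_max_left _ _)
  · have he : (Finset.univ : Finset ι) = ∅ := Finset.not_nonempty_iff_eq_empty.mp hne
    rw [he, Finset.sum_empty, zero_add]
    nlinarith

end LawDec

end Quant

end Summit.CriticalPhenomena.PercolationContinuityZ3.Theorems
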